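import Literature.NumberTheory.Sieve.MitsuiTotallyReal
import HarnessLib

/-!
# Hinz's Bombieri–Vinogradov theorem for totally real fields (named fact) and the discharge of
# Castillo–Hall–Lemke Oliver–Pollack–Thompson Theorem 1.1 from it

Topic `Literature/NumberTheory/Sieve`. The named fact
`Literature.NumberTheory.Sieve.castilloEtAl2015_thm_1_1_totallyReal` (`BoundedGapsNumberFields.lean`:
bounded gaps between prime elements of a totally real number field, A. Castillo, C. Hall,
R. J. Lemke Oliver, P. Pollack, L. Thompson, Proc. AMS 143 (2015) = arXiv:1403.5808, Theorem 1.1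
with `m = 2`, `k₀ = 105`) has been reduced in this directory to exactly ONE external theorem:

* the Maynard–Tao sieve over `𝓞_K` (Proposition 2.1 via Lemmas 2.2–2.5, Maynard's Lemmas 5.1–6.3
  over ideals, Corollary 2.6, `M₁₀₅ > 4`) is PROVED (`MaynardNF*.lean`,
  `Literature.NumberTheory.Sieve.MaynardNF.castillo_of_hinz_mitsui`);
* Mitsui's prime number theorem for the boxes (`Literature.NumberTheory.Sieve.MaynardNF.PrimesAsymptotic`)
  is PROVED (`Literature.NumberTheory.Sieve.MitsuiPNT.primesAsymptotic`, `MitsuiTotallyReal.lean`);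
* what remains is Theorem 2.7 of the paper — Hinz's Bombieri–Vinogradov theorem: for totally real
  `K` the prime elements of the boxes `A(N)` have every level of distribution `θ < 1/2`
  (`Literature.NumberTheory.Sieve.MitsuiPNT.castillo_of_hinz`).

This file records that remaining input as the named fact
`Literature.NumberTheory.Sieve.castilloEtAl2015_thm_2_7_hinz` (verbatim Theorem 2.7 of the paper,
totally real case, over the tree's definition `Literature.NumberTheory.Sieve.MaynardNF.PrimesHaveLevel`
= the displayed definition of "level of distribution" of §2.1) and PROVES the assembly
`Literature.NumberTheory.Sieve.castilloEtAl2015_thm_1_1_totallyReal_holds_of :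
castilloEtAl2015_thm_2_7_hinz → castilloEtAl2015_thm_1_1_totallyReal`.

The child does not restate the parent: Theorem 2.7 is a mean-value bound for the errors
`𝓔(N; 𝔮) = max_{(α₀,𝔮)=1} ||P(N; 𝔮, α₀)| − |P(N)|/φ(𝔮)|` over `N𝔮 ≤ |A(N)|^θ`; Theorem 1.1 is the
existence of infinitely many translates of an admissible tuple containing two prime elements.

## Faithfulness notes

* "level of distribution `θ`" is `MaynardNF.PrimesHaveLevel K θ` (file `MaynardNFPrimes.lean`), the
  displayed definition of §2.1 verbatim (boxes `A(N) = A₀(2N) ∖ A₀(N)`, prime ELEMENTS, `φ(𝔮) =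
  |(𝓞_K/𝔮)ˣ|`, "`≪_B`" = a constant depending on `B` for `N ≥ N₀(B)`).
* Only `0 < θ < 1/2` is recorded ("for any `θ < 1/2`"; `θ ≤ 0` is vacuous for the sieve and is the
  only range `castillo_of_hinz` consumes). The general-signature clause "`θ < 1/(r₂ + 5/2)`" is NOT
  vendored (not needed; the parent is the totally real case).
* The paper: "Theorem 2.7 is contained in the somewhat more general main theorem of [Hinz 1988]"
  (J. Hinz, *A generalization of Bombieri's prime number theorem to algebraic number fields*, Acta
  Arith. 51 (1988), 173–193: a Bombieri–Vinogradov theorem for totally positive prime elements in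
  boxes and coprime residue classes, level `x^{1/2}(log x)^{-B}` in the totally real case).

## References

* Castillo–Hall–Lemke Oliver–Pollack–Thompson, arXiv:1403.5808 = Proc. AMS 143 (2015), §2.1,
  Theorem 2.7, §3.1. [CastilloEtAl2015]
* J. Hinz, Acta Arith. 51 (1988), 173–193, main theorem. [Hinz1988]
-/

noncomputable section

namespace Literature.NumberTheory.Sieve

/-- NAMED FACT — **Castillo–Hall–Lemke Oliver–Pollack–Thompson 2015, Theorem 2.7 (Hinz), totally
real case**: "Let `K/ℚ` be a number field with `r₂` pairs of complex conjugate embeddings. If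
`r₂ = 0` (i.e., `K` is totally real), the set `P` of primes of `𝓞_K` has level of distribution `θ`
for any `θ < 1/2`." Here "level of distribution `θ`" is the displayed definition of §2.1,
`Literature.NumberTheory.Sieve.MaynardNF.PrimesHaveLevel K θ`: for every `B > 0`,
`∑_{N𝔮 ≤ Q} max_{(α₀,𝔮)=1} |𝓔(N; 𝔮, α₀)| ≤ C_B |A(N)|/(log N)^B` for all `Q ≤ |A(N)|^θ` and all
`N ≥ N₀(B)`, `P(N)` = the prime elements of the box `A(N) ⊆ 𝓞_K`. "Theorem 2.7 is contained in the
somewhat more general main theorem of [Hinz 1988]" (Hinz's generalisation of Bombieri's theorem to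
totally real fields). Recorded for `0 < θ < 1/2`.
Users take `(h : castilloEtAl2015_thm_2_7_hinz)`.
[cite: CastilloEtAl2015, Theorem 2.7 (r₂ = 0) with §2.1 (level of distribution)]
[cite: Hinz1988, main theorem (as quoted in Castillo et al., Theorem 2.7)] -/
def castilloEtAl2015_thm_2_7_hinz : Prop :=
  ∀ (K : Type) [Field K] [NumberField K] [NumberField.IsTotallyReal K],
    ∀ θ : ℝ, 0 < θ → θ < 1 / 2 → MaynardNF.PrimesHaveLevel K θ

/-- **Assembly (PROVED): Theorem 1.1 (totally real, `m = 2`, `k₀ = 105`) from Theorem 2.7 (Hinz).**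
`Literature.NumberTheory.Sieve.castilloEtAl2015_thm_1_1_totallyReal` follows from
`Literature.NumberTheory.Sieve.castilloEtAl2015_thm_2_7_hinz` by
`Literature.NumberTheory.Sieve.MitsuiPNT.castillo_of_hinz` (the Maynard–Tao sieve over `𝓞_K` and
Mitsui's prime number theorem for the boxes being proved in this directory).
[cite: CastilloEtAl2015, Theorem 1.1, §3.1] -/
theorem castilloEtAl2015_thm_1_1_totallyReal_holds_of (h : castilloEtAl2015_thm_2_7_hinz) :
    castilloEtAl2015_thm_1_1_totallyReal :=
  MitsuiPNT.castillo_of_hinz h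

end Literature.NumberTheory.Sieve
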